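import Summits.AtomisticToContinuum.Crystallization.Theorems.OverbindingBudgetAffineNearCollarCutA

/-!
# OverbindingBudget · near regime «CollarCut» (lens-4 g73: core/shell split of the near class, RC NearPricedCoreFloor / RS NearPricedShellFloor, glue RC ∧ RS ⇒ R0ᴬ, cones) — part 2 of 2 (sequel of `…OverbindingBudgetAffineNearCollarCutA`)

Split for the 400-line cap by the landing lane (hand-2 g34); the module docstring of part 1 (`…OverbindingBudgetAffineNearCollarCutA`) describes the whole node.  Same namespace; all FQNs unchanged.
0 sorry; standard axioms.
-/


namespace Summit.AtomisticToContinuum.Crystallization.Theorems.OverbindingBudgetAffineNearCluster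

open scoped BigOperators Classical
open Literature.MathematicalPhysics.StatisticalMechanics
open Literature.Geometry.DiscreteGeometry (nearestDist)
open Summit.AtomisticToContinuum.Crystallization.Theorems.OverbindingBudgetMisfitWindowStatements (InWindow)
open Summit.AtomisticToContinuum.Crystallization.Theses.OverbindingBudget (RobustDefectLimitWindows)
open Summit.AtomisticToContinuum.Crystallization.Theses.PricedLinkCensus (ChargedEnergyGap)
open Summit.AtomisticToContinuum.Crystallization.Theorems.OverbindingBudgetGradedBareness (CleanlessExcessT)
open Summit.AtomisticToContinuum.Crystallization.Theorems.OverbindingBudgetCoherentCut (CoherentResidual)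
open Summit.AtomisticToContinuum.Crystallization.Theorems.OverbindingBudgetTwoShellShape (TwoShellShape)
open Summit.AtomisticToContinuum.Crystallization.Theorems.OverbindingBudgetBalancedCensusStatements
open Summit.AtomisticToContinuum.Crystallization.Theorems.OverbindingBudgetBalancedCensusRecord
open Summit.AtomisticToContinuum.Crystallization.Theorems.OverbindingBudgetHarmonicNormalForm
open Summit.AtomisticToContinuum.Crystallization.Theorems.OverbindingBudgetLocalHarmonicCertificate
open Summit.AtomisticToContinuum.Crystallization.Theorems.OverbindingBudgetAffineLadder
open Summit.AtomisticToContinuum.Crystallization.Theorems.OverbindingBudgetAffineLocalisation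

variable {N : ℕ}
local notation "E3" => EuclideanSpace ℝ (Fin 3)

/-! ## §3  The two pieces of the collar cut -/

/-- **RC · `NearPricedCoreFloor η R Rc δm ρ₁ θ θ₀ κ t w rL`** (NEW · TRUE-type on paper · ATTACKABLE-L · UNDECIDED; the BULK theorem of the priced
skeleton floor).  Given K_at⁰ and R_aff there is a wall price `A ≥ 0` such that for every `ν > 0` there is a scale `ℓ₀(ν)` such that for every
`ℓ ≥ ℓ₀` some `ε₀ > 0` works (all `ε₁ ≤ ε₀`, all windows, some `C ≥ 0`): for EVERY injective `y` and EVERY admissible skeleton equilibrium `(F, z)`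
of scale `ℓ`, on the CORE `core := nearCore (2ℓ + 2Rc)` (= relaxed cells and deep-wall zones only, `nearCore_subset_free_union_wallZone`):
`#core·e⋆ − C·#Gᶜ − κ·#Far − ν·Q₁(core; y, z) − A·Σ_{j ∈ W ∩ core} ‖classForce y j‖² ≤ ½·pairSum core G z`.
No collar, no credit, no near/far interface and no incoherent matter within `2ℓ + 2Rc` of a floored site: the cells' Cauchy–Born floor
(sitewise `W ≥ e⋆ + c_W|E|²`, interior regularity of the cell equilibria, inner-expansion remainder), the priced walls (`W×` by Cauchy–Schwarz,
g71 memo §3), and the one NEW term, the CUT FLUX: the null-Lagrangian face term `M(∇u)⫶∇²u_z·n` (`M` = the fourth-moment tensor of g72 §4)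
through the core's boundary layer.  WHY THE RADIUS `2ℓ + 2Rc`: (i) the layer has `≤ C(ℓ, δ)·(#Far + #Gᶜ)` sites (packing: every one is within
`2ℓ + 2Rc + 1` of non-near matter); (ii) a cell meeting the cut (diameter `≤ ℓ`) stays `≥ ℓ + 2Rc` away from non-near matter, hence beyond the
collar's sources (class-asymmetry forces, interface mismatch: range `≈ 12`, shielded by at least one pinned wall where `w = z − y = 0`), so on it
`|∇²u_z| ≤ C(ε₁ + d⁻⁴)·ℓ²` (registration + the cut cell's own load, `d ≥ ℓ + 2Rc`); (iii) next to FAR matter the near matter on both sides of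
the cut is strained / off-scale by `≥ θ₀/2` over `θ₀/(Cε₁) ≫ 2ℓ + 2Rc` layers (registration continuity), so the strained-zone surplus
`≥ c_W θ₀²/4` per site on `2ℓ + 2Rc` layers pays the flux per cut column (ratio `∝ ℓ⁻³`; `ℓ₀(ν)` absorbs the constants); next to BAD matter
`C` (chosen last) pays.  WHY IT MIGHT FAIL: R0's smooth part (CB-equilibrated smoothing of `z` on a cell up to rough pinned walls; the wall work
`W×` against `A·Σ_W‖classForce y‖²` at the record `rL = 12`), and the cut flux in the ALIGNED-WALL worst case (a pinned wall lying along the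
cut next to a thick far slab: flux `|M|·|∇w|` on every cut site, paid only by the strained-zone surplus — back of the envelope needs `ℓ ≳ 50`).
Census: ⑨ (wall work) and ⑨d (collar-cut face flux).  Independent of the collar credit (⑨b). [lens-4 g73; Blanc–Le Bris–Lions 2002, E–Ming 2007 Thm 2.2 / §§4–6,
Ortner–Theil 2013 Thm 3.3, Ehrlacher–Ortner–Shapeev 2016 §2, Hudson–Ortner 2014 §4 — orientation only, nothing imported] -/
def NearPricedCoreFloor (η R Rc δm ρ₁ θ θ₀ κ t w rL : ℝ) : Prop :=
  (∃ μ₁ μR : ℝ, 0 < μ₁ ∧ 0 < μR ∧ PureMarginStabilityAt η μ₁ μR R) → AffineChartStraightening →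
    ∃ A : ℝ, 0 ≤ A ∧
    ∀ ν : ℝ, 0 < ν → ∃ ℓ₀ : ℝ, ∀ ℓ : ℝ, ℓ₀ ≤ ℓ →
      ∃ ε₀ : ℝ, 0 < ε₀ ∧ ∀ ε₁ : ℝ, 0 < ε₁ → ε₁ ≤ ε₀ → ∀ δ : ℝ, 0 < δ → δ ≤ 2 →
        ∃ C : ℝ, 0 ≤ C ∧ ∀ (N : ℕ) (y : Fin N → E3), Function.Injective y →
          ∀ (F : Finset (Fin N)) (z : Fin N → E3), CellSkeleton ℓ t w Rc θ₀ ρ₁ ε₁ θ δ y F → (∀ k, y k ≠ z k → k ∈ F) →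
            ClassCritical θ₀ ρ₁ ε₁ θ δ y z F → RefAdmissible η R Rc δm θ₀ ρ₁ ε₁ θ δ y z →
              ((nearCore (2 * ℓ + 2 * Rc) θ₀ ρ₁ ε₁ θ δ y).card : ℝ) * (⨅ Q : PeriodicConfiguration 3, Q.energyPerParticle lennardJones)
                - C * (((goodSet ρ₁ ε₁ θ δ y)ᶜ).card : ℝ) - κ * ((farSet θ₀ ρ₁ ε₁ θ δ y).card : ℝ)
                - ν * dispGradSum (101 / 100) (nearCore (2 * ℓ + 2 * Rc) θ₀ ρ₁ ε₁ θ δ y) (goodSet ρ₁ ε₁ θ δ y) y z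
                - A * (∑ j ∈ (wallZone ℓ rL Rc θ₀ ρ₁ ε₁ θ δ y F).filter
                    (fun j => j ∈ nearCore (2 * ℓ + 2 * Rc) θ₀ ρ₁ ε₁ θ δ y), forceContent θ₀ ρ₁ ε₁ θ δ y j)
                ≤ 1 / 2 * pairSum (nearCore (2 * ℓ + 2 * Rc) θ₀ ρ₁ ε₁ θ δ y) (goodSet ρ₁ ε₁ θ δ y) z

/-- **RS · `NearPricedShellFloor η R Rc δm ρ₁ θ θ₀ κ t w rL`** (NEW · TRUE-type on paper · ATTACKABLE-M · UNDECIDED · INSTRUMENTABLE by census ⑨b;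
the COLLAR theorem of the priced skeleton floor).  Given K_at⁰ and R_aff there are a wall price `A ≥ 0` and a collar credit `cE > 0` such that for
every `ν > 0` … (same scale order) …: for EVERY injective `y` and EVERY admissible skeleton equilibrium `(F, z)` of scale `ℓ`, on the SHELL
`shell := nearShell (2ℓ + 2Rc)` (the near sites within `2ℓ + 2Rc` of far or bad matter; it contains the whole credited collar,
`collarPinned_subset_nearShell`):
`#shell·e⋆ − C·#Gᶜ − κ·#Far − ν·Q₁(shell; y, z) − A·Σ_{j ∈ W ∩ shell} ‖classForce y j‖² + cE·Σ_{j ∈ P} ‖classForce y j‖² ≤ ½·pairSum shell G z`,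
`P = collarPinned ℓ rL`.  Here live: the telescoped null-Lagrangian flux at the near/far and near/bad interfaces and at the cut (paid by the
near-side strain surplus `c_W|E|² ≥ c_W θ₀²/4` next to far matter, by `C` next to bad matter); the near-side tails against denser incoherent
matter (slot Z's wall lemma: `≤ C′` per bad site in total); the CLASS-ASYMMETRY force content of far-adjacent collar sites
(`classForce (Near, G) y = 2F^{Near} + F^{Far}`, so an equilibrated `y` still carries `‖F^{Far}‖² ≈ Rc⁻⁸` there) and the unrelaxed-shuffle
content `k_s²|E|²` of strained hcp-type pinned matter — whose CREDIT at rate `cE` is the Polyak–Łojasiewicz slack of REGISTERED pinned matter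
(`affDeepReg_of_mem_collarPinned`): unrelaxed matter exceeds its locally relaxed state by `≥ ‖force‖²/(2λ_max)`, and the relaxed two-lattice
state obeys `W_relax(B) ≥ e⋆ + c_W|E|²`.  Every shell site is within `2ℓ + 2Rc` of budgeted matter (`#shell ≤ C(ℓ, δ)·(#Far + #Gᶜ)`), but the
per-site budget next to FAR matter is only `κ/C(ℓ)`: the shell is NOT the chargeable case.  WHY IT MIGHT FAIL: the credit rate — census ⑨b
(PL ratio of the unrelaxed-shuffle surplus, additivity to `c_W|E|²`); if ⑨b fails the credit is re-typed capped (`cE·Σ_P min(‖classForce y‖², θ₀²)`)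
and RC is untouched. [lens-4 g73; Theil 2006 / Flatley–Theil 2015 (LJ equation of state), E–Ming 2007 §5 (complex lattices, inner shifts),
Karimi–Nutini–Schmidt 2016 §2 (PL inequality), Braun–Schmidt 2013 (surface terms) — orientation only, nothing imported] -/
def NearPricedShellFloor (η R Rc δm ρ₁ θ θ₀ κ t w rL : ℝ) : Prop :=
  (∃ μ₁ μR : ℝ, 0 < μ₁ ∧ 0 < μR ∧ PureMarginStabilityAt η μ₁ μR R) → AffineChartStraightening →
    ∃ A : ℝ, 0 ≤ A ∧ ∃ cE : ℝ, 0 < cE ∧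
    ∀ ν : ℝ, 0 < ν → ∃ ℓ₀ : ℝ, ∀ ℓ : ℝ, ℓ₀ ≤ ℓ →
      ∃ ε₀ : ℝ, 0 < ε₀ ∧ ∀ ε₁ : ℝ, 0 < ε₁ → ε₁ ≤ ε₀ → ∀ δ : ℝ, 0 < δ → δ ≤ 2 →
        ∃ C : ℝ, 0 ≤ C ∧ ∀ (N : ℕ) (y : Fin N → E3), Function.Injective y →
          ∀ (F : Finset (Fin N)) (z : Fin N → E3), CellSkeleton ℓ t w Rc θ₀ ρ₁ ε₁ θ δ y F → (∀ k, y k ≠ z k → k ∈ F) →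
            ClassCritical θ₀ ρ₁ ε₁ θ δ y z F → RefAdmissible η R Rc δm θ₀ ρ₁ ε₁ θ δ y z →
              ((nearShell (2 * ℓ + 2 * Rc) θ₀ ρ₁ ε₁ θ δ y).card : ℝ) * (⨅ Q : PeriodicConfiguration 3, Q.energyPerParticle lennardJones)
                - C * (((goodSet ρ₁ ε₁ θ δ y)ᶜ).card : ℝ) - κ * ((farSet θ₀ ρ₁ ε₁ θ δ y).card : ℝ)
                - ν * dispGradSum (101 / 100) (nearShell (2 * ℓ + 2 * Rc) θ₀ ρ₁ ε₁ θ δ y) (goodSet ρ₁ ε₁ θ δ y) y z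
                - A * (∑ j ∈ (wallZone ℓ rL Rc θ₀ ρ₁ ε₁ θ δ y F).filter
                    (fun j => j ∈ nearShell (2 * ℓ + 2 * Rc) θ₀ ρ₁ ε₁ θ δ y), forceContent θ₀ ρ₁ ε₁ θ δ y j)
                + cE * (∑ j ∈ collarPinned ℓ rL Rc θ₀ ρ₁ ε₁ θ δ y F, forceContent θ₀ ρ₁ ε₁ θ δ y j)
                ≤ 1 / 2 * pairSum (nearShell (2 * ℓ + 2 * Rc) θ₀ ρ₁ ε₁ θ δ y) (goodSet ρ₁ ε₁ θ δ y) z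

/-- **Degenerate consistency (PROVED):** RC's inequality holds trivially when the core is EMPTY (thin near matter: `nearCore_eq_empty_of_deepPinned_empty`),
for any nonnegative rates — the boundary-dominated case is the shell's, as it should be. [this file] -/
theorem corePricedFloor_ineq_of_nearCore_eq_empty {C κ ν A ℓ rL Rc θ₀ ρ₁ ε₁ θ δ : ℝ} (hC : 0 ≤ C) (hκ : 0 ≤ κ)
    {y z : Fin N → E3} {F : Finset (Fin N)} (h : nearCore (2 * ℓ + 2 * Rc) θ₀ ρ₁ ε₁ θ δ y = ∅) :
    ((nearCore (2 * ℓ + 2 * Rc) θ₀ ρ₁ ε₁ θ δ y).card : ℝ) * (⨅ Q : PeriodicConfiguration 3, Q.energyPerParticle lennardJones)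
      - C * (((goodSet ρ₁ ε₁ θ δ y)ᶜ).card : ℝ) - κ * ((farSet θ₀ ρ₁ ε₁ θ δ y).card : ℝ)
      - ν * dispGradSum (101 / 100) (nearCore (2 * ℓ + 2 * Rc) θ₀ ρ₁ ε₁ θ δ y) (goodSet ρ₁ ε₁ θ δ y) y z
      - A * (∑ j ∈ (wallZone ℓ rL Rc θ₀ ρ₁ ε₁ θ δ y F).filter
          (fun j => j ∈ nearCore (2 * ℓ + 2 * Rc) θ₀ ρ₁ ε₁ θ δ y), forceContent θ₀ ρ₁ ε₁ θ δ y j)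
      ≤ 1 / 2 * pairSum (nearCore (2 * ℓ + 2 * Rc) θ₀ ρ₁ ε₁ θ δ y) (goodSet ρ₁ ε₁ θ δ y) z := by
  have hW : (wallZone ℓ rL Rc θ₀ ρ₁ ε₁ θ δ y F).filter (fun j => j ∈ nearCore (2 * ℓ + 2 * Rc) θ₀ ρ₁ ε₁ θ δ y) = ∅ :=
    Finset.filter_eq_empty_iff.mpr fun j _ => by rw [h]; exact Finset.notMem_empty j
  rw [hW, h]
  unfold pairSum dispGradSum
  simp only [Finset.card_empty, Nat.cast_zero, zero_mul, Finset.sum_empty, mul_zero, sub_zero]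
  have h1 : 0 ≤ C * (((goodSet ρ₁ ε₁ θ δ y)ᶜ).card : ℝ) := by positivity
  have h2 : 0 ≤ κ * ((farSet θ₀ ρ₁ ε₁ θ δ y).card : ℝ) := by positivity
  linarith

/-! ## §4  The glue (PROVED): RC ∧ RS ⇒ R0ᴬ -/

/-- **SEAM (PROVED): RC(κ_c) ∧ RS(κ_s) ⇒ R0ᴬ(κ) for `κ_c + κ_s ≤ κ`.**  Rates `A := max A_c A_s`, `cE := cE_s`; given `ν`, `ℓ₀ := max`, `ε₀ := min`,
`C := C_c + C_s`; for an admissible skeleton equilibrium add the two inequalities: every atom of R0ᴬ is additive over `Near = core ⊔ shell`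
(`card_nearSet_eq_core_add_shell`, `pairSum_nearSet_eq_core_add_shell`, `dispGradSum_nearSet_eq_core_add_shell`, `sum_wallZone_eq_core_add_shell`),
the larger price and far rate only weaken. [this file] -/
theorem nearPricedSkeletonFloor_of_core_of_shell {η R Rc δm ρ₁ θ θ₀ κc κs κ t w rL : ℝ} (hκ : κc + κs ≤ κ)
    (hRC : NearPricedCoreFloor η R Rc δm ρ₁ θ θ₀ κc t w rL) (hRS : NearPricedShellFloor η R Rc δm ρ₁ θ θ₀ κs t w rL) :
    NearPricedSkeletonFloor η R Rc δm ρ₁ θ θ₀ κ t w rL := by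
  intro hK hR
  obtain ⟨Ac, hAc, hC1⟩ := hRC hK hR
  obtain ⟨As, hAs, cE, hcE, hS1⟩ := hRS hK hR
  refine ⟨max Ac As, le_trans hAc (le_max_left _ _), cE, hcE, fun ν hν => ?_⟩
  obtain ⟨ℓc, hC2⟩ := hC1 ν hν
  obtain ⟨ℓs, hS2⟩ := hS1 ν hν
  refine ⟨max ℓc ℓs, fun ℓ hℓ => ?_⟩
  obtain ⟨ε₀c, hε₀c, hC3⟩ := hC2 ℓ (le_trans (le_max_left _ _) hℓ)
  obtain ⟨ε₀s, hε₀s, hS3⟩ := hS2 ℓ (le_trans (le_max_right _ _) hℓ)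
  refine ⟨min ε₀c ε₀s, lt_min hε₀c hε₀s, fun ε₁ hε₁ hle δ hδ hδ2 => ?_⟩
  obtain ⟨Cc, hCc, hC4⟩ := hC3 ε₁ hε₁ (hle.trans (min_le_left _ _)) δ hδ hδ2
  obtain ⟨Cs, hCs, hS4⟩ := hS3 ε₁ hε₁ (hle.trans (min_le_right _ _)) δ hδ hδ2
  refine ⟨Cc + Cs, by positivity, fun N y hy F z hsk hsupp hcrit hadm => ?_⟩
  have hc := hC4 N y hy F z hsk hsupp hcrit hadm
  have hs := hS4 N y hy F z hsk hsupp hcrit hadm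
  clear hC4 hS4 hC3 hS3 hC2 hS2 hC1 hS1 hRC hRS
  have hfc0 : ∀ j, 0 ≤ forceContent θ₀ ρ₁ ε₁ θ δ y j := fun j => forceContent_nonneg θ₀ ρ₁ ε₁ θ δ y j
  have hcardE : ((nearSet θ₀ ρ₁ ε₁ θ δ y).card : ℝ) * (⨅ Q : PeriodicConfiguration 3, Q.energyPerParticle lennardJones)
      = ((nearCore (2 * ℓ + 2 * Rc) θ₀ ρ₁ ε₁ θ δ y).card : ℝ) * (⨅ Q : PeriodicConfiguration 3, Q.energyPerParticle lennardJones)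
        + ((nearShell (2 * ℓ + 2 * Rc) θ₀ ρ₁ ε₁ θ δ y).card : ℝ) * (⨅ Q : PeriodicConfiguration 3, Q.energyPerParticle lennardJones) := by
    rw [← add_mul, card_nearSet_eq_core_add_shell (2 * ℓ + 2 * Rc) θ₀ ρ₁ ε₁ θ δ y]
  have hpair := pairSum_nearSet_eq_core_add_shell (2 * ℓ + 2 * Rc) θ₀ ρ₁ ε₁ θ δ (goodSet ρ₁ ε₁ θ δ y) y z
  have hQν : ν * dispGradSum (101 / 100) (nearSet θ₀ ρ₁ ε₁ θ δ y) (goodSet ρ₁ ε₁ θ δ y) y z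
      = ν * dispGradSum (101 / 100) (nearCore (2 * ℓ + 2 * Rc) θ₀ ρ₁ ε₁ θ δ y) (goodSet ρ₁ ε₁ θ δ y) y z
        + ν * dispGradSum (101 / 100) (nearShell (2 * ℓ + 2 * Rc) θ₀ ρ₁ ε₁ θ δ y) (goodSet ρ₁ ε₁ θ δ y) y z := by
    rw [← mul_add, dispGradSum_nearSet_eq_core_add_shell (101 / 100) (2 * ℓ + 2 * Rc) θ₀ ρ₁ ε₁ θ δ (goodSet ρ₁ ε₁ θ δ y) y y z]
  have hW := sum_wallZone_eq_core_add_shell ℓ rL Rc θ₀ ρ₁ ε₁ θ δ (2 * ℓ + 2 * Rc) y F (forceContent θ₀ ρ₁ ε₁ θ δ y)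
  have hWc : 0 ≤ ∑ j ∈ (wallZone ℓ rL Rc θ₀ ρ₁ ε₁ θ δ y F).filter
      (fun j => j ∈ nearCore (2 * ℓ + 2 * Rc) θ₀ ρ₁ ε₁ θ δ y), forceContent θ₀ ρ₁ ε₁ θ δ y j :=
    Finset.sum_nonneg fun j _ => hfc0 j
  have hWs : 0 ≤ ∑ j ∈ (wallZone ℓ rL Rc θ₀ ρ₁ ε₁ θ δ y F).filter
      (fun j => j ∈ nearShell (2 * ℓ + 2 * Rc) θ₀ ρ₁ ε₁ θ δ y), forceContent θ₀ ρ₁ ε₁ θ δ y j :=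
    Finset.sum_nonneg fun j _ => hfc0 j
  have hFar : 0 ≤ ((farSet θ₀ ρ₁ ε₁ θ δ y).card : ℝ) := Nat.cast_nonneg _
  have h1 : Ac * (∑ j ∈ (wallZone ℓ rL Rc θ₀ ρ₁ ε₁ θ δ y F).filter
        (fun j => j ∈ nearCore (2 * ℓ + 2 * Rc) θ₀ ρ₁ ε₁ θ δ y), forceContent θ₀ ρ₁ ε₁ θ δ y j)
      ≤ max Ac As * (∑ j ∈ (wallZone ℓ rL Rc θ₀ ρ₁ ε₁ θ δ y F).filter
        (fun j => j ∈ nearCore (2 * ℓ + 2 * Rc) θ₀ ρ₁ ε₁ θ δ y), forceContent θ₀ ρ₁ ε₁ θ δ y j) :=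
    mul_le_mul_of_nonneg_right (le_max_left _ _) hWc
  have h2 : As * (∑ j ∈ (wallZone ℓ rL Rc θ₀ ρ₁ ε₁ θ δ y F).filter
        (fun j => j ∈ nearShell (2 * ℓ + 2 * Rc) θ₀ ρ₁ ε₁ θ δ y), forceContent θ₀ ρ₁ ε₁ θ δ y j)
      ≤ max Ac As * (∑ j ∈ (wallZone ℓ rL Rc θ₀ ρ₁ ε₁ θ δ y F).filter
        (fun j => j ∈ nearShell (2 * ℓ + 2 * Rc) θ₀ ρ₁ ε₁ θ δ y), forceContent θ₀ ρ₁ ε₁ θ δ y j) :=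
    mul_le_mul_of_nonneg_right (le_max_right _ _) hWs
  have h3 : (κc + κs) * ((farSet θ₀ ρ₁ ε₁ θ δ y).card : ℝ) ≤ κ * ((farSet θ₀ ρ₁ ε₁ θ δ y).card : ℝ) :=
    mul_le_mul_of_nonneg_right hκ hFar
  rw [hcardE, hpair, hQν, hW]
  linarith only [hc, hs, h1, h2, h3]

/-! ## §5  The cones: R0ᴬ and R0⁻ at the record literals, RD0c, TBDSG, the RDEF shape -/

/-- **R0ᴬ at the record literals from RC ∧ RS (PROVED):** `(η, R, Rc, δm, ρ₁, θ, θ₀, t, w, rL) = (3/2000, 4, 6, 1/1000, 12, 1/25, 1/2000, 4, 6, 12)`,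
RC and RS at far rate `κ₁/4 = 1/(4·10⁷)/4`, R0ᴬ at `κ₁/2`. [this file] -/
theorem nearPricedSkeletonFloor_record_of_core_of_shell
    (hRC : NearPricedCoreFloor (3 / 2000) 4 6 (1 / 1000) 12 (1 / 25) (1 / 2000) (1 / (4 * 10 ^ 7) / 4) 4 6 12)
    (hRS : NearPricedShellFloor (3 / 2000) 4 6 (1 / 1000) 12 (1 / 25) (1 / 2000) (1 / (4 * 10 ^ 7) / 4) 4 6 12) :
    NearPricedSkeletonFloor (3 / 2000) 4 6 (1 / 1000) 12 (1 / 25) (1 / 2000) (1 / (4 * 10 ^ 7) / 2) 4 6 12 :=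
  nearPricedSkeletonFloor_of_core_of_shell (by norm_num) hRC hRS

/-- **R0⁻ at the record literals from RC ∧ RS ∧ FC (PROVED)**, through g72's `nearLightSkeletonFloor_record_of_priced`. [this file] -/
theorem nearLightSkeletonFloor_record_of_core_of_shell
    (hRC : NearPricedCoreFloor (3 / 2000) 4 6 (1 / 1000) 12 (1 / 25) (1 / 2000) (1 / (4 * 10 ^ 7) / 4) 4 6 12)
    (hRS : NearPricedShellFloor (3 / 2000) 4 6 (1 / 1000) 12 (1 / 25) (1 / 2000) (1 / (4 * 10 ^ 7) / 4) 4 6 12)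
    (hFC : ForceContentVisible (3 / 2000) 4 6 (1 / 1000) 12 (1 / 25) (1 / 2000) 4 6) :
    NearLightSkeletonFloor (3 / 2000) 4 6 (1 / 1000) 12 (1 / 25) (1 / 2000) (1 / (4 * 10 ^ 7)) 4 6 320 12 :=
  nearLightSkeletonFloor_record_of_priced (nearPricedSkeletonFloor_record_of_core_of_shell hRC hRS) hFC

/-- **K-side → CP⁺ → RC → RS → FC → RD0c (PROVED)**, general literals, through g72's `nearReferenceCritical_of_pricedFloor`. [this file] -/
theorem nearReferenceCritical_of_core_of_shell {η R Rc δm ρ₁ θ θ₀ κ₁ t w ϖ rL : ℝ} (hϖ : 0 ≤ ϖ) (hκ₁ : 0 < κ₁)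
    (hK : ∃ μ₁ μR : ℝ, 0 < μ₁ ∧ 0 < μR ∧ PureMarginStabilityAt η μ₁ μR R)
    (hCP : NearLightSkeletonEquilibrium η R Rc δm ρ₁ θ θ₀ t w ϖ rL)
    (hRC : NearPricedCoreFloor η R Rc δm ρ₁ θ θ₀ (κ₁ / 4) t w rL) (hRS : NearPricedShellFloor η R Rc δm ρ₁ θ θ₀ (κ₁ / 4) t w rL)
    (hFC : ForceContentVisible η R Rc δm ρ₁ θ θ₀ t w) :
    NearReferenceCriticalFloor η R Rc δm ρ₁ θ θ₀ κ₁ :=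
  nearReferenceCritical_of_pricedFloor hϖ hκ₁ hK hCP
    (nearPricedSkeletonFloor_of_core_of_shell (κ := κ₁ / 2) (by linarith) hRC hRS) hFC

/-- **LINE CONE through the collar cut at the record literals:** `K_at⁰ ∧ R_aff ∧ CP⁺ ∧ RC ∧ RS ∧ FC ∧ N2 ∧ Z ∧ M ⟹
TameBalancedDeepScaleGap (122/125) 0 4 (3/50) (1/450)` through g72's `tbdsg_of_nearPricedFloor_record` / the tree's `tbdsg_of_nearLightSkeleton_record` /
the cone of record `tbdsg_of_nearCritical_record'_bt_d` (UNCHANGED). [this file] -/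
theorem tbdsg_of_collarCut_record
    (hK : ∃ μ₁ μR : ℝ, 0 < μ₁ ∧ 0 < μR ∧ PureMarginStabilityAt (3 / 2000) μ₁ μR 4) (hR : AffineChartStraightening)
    (hCP : NearLightSkeletonEquilibrium (3 / 2000) 4 6 (1 / 1000) 12 (1 / 25) (1 / 2000) 4 6 320 12)
    (hRC : NearPricedCoreFloor (3 / 2000) 4 6 (1 / 1000) 12 (1 / 25) (1 / 2000) (1 / (4 * 10 ^ 7) / 4) 4 6 12)
    (hRS : NearPricedShellFloor (3 / 2000) 4 6 (1 / 1000) 12 (1 / 25) (1 / 2000) (1 / (4 * 10 ^ 7) / 4) 4 6 12)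
    (hFC : ForceContentVisible (3 / 2000) 4 6 (1 / 1000) 12 (1 / 25) (1 / 2000) 4 6)
    (h2 : NearSecondOrderFloor (3 / 2000) 4 6 (1 / 1000) 12 (1 / 25) (1 / 2000) (1 / (4 * 10 ^ 7)))
    (hZ : FarAggregatePricing 12 (1 / 25) (1 / 2000) (1 / (2 * 10 ^ 7))) (hM : AffMidAll 12 (1 / 25)) :
    TameBalancedDeepScaleGap (122 / 125) 0 4 (3 / 50) (1 / 450) :=
  tbdsg_of_nearPricedFloor_record hK hR hCP (nearPricedSkeletonFloor_record_of_core_of_shell hRC hRS) hFC h2 hZ hM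

/-- **The residual RDEF through the collar cut** (record shape; slot 3 now `K_at⁰ ∧ R_aff ∧ CP⁺ ∧ RC ∧ RS ∧ FC ∧ N2 ∧ Z ∧ M`; CEG, T, CE, Res are
the other RDEF slots). [this file] -/
theorem rdef_of_ceg_shape_collarCut_record (hCEG : ChargedEnergyGap) (hT : TwoShellShape (1 / 100) (3 / 50) (1 / 450))
    (hK : ∃ μ₁ μR : ℝ, 0 < μ₁ ∧ 0 < μR ∧ PureMarginStabilityAt (3 / 2000) μ₁ μR 4) (hR : AffineChartStraightening)
    (hCP : NearLightSkeletonEquilibrium (3 / 2000) 4 6 (1 / 1000) 12 (1 / 25) (1 / 2000) 4 6 320 12)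
    (hRC : NearPricedCoreFloor (3 / 2000) 4 6 (1 / 1000) 12 (1 / 25) (1 / 2000) (1 / (4 * 10 ^ 7) / 4) 4 6 12)
    (hRS : NearPricedShellFloor (3 / 2000) 4 6 (1 / 1000) 12 (1 / 25) (1 / 2000) (1 / (4 * 10 ^ 7) / 4) 4 6 12)
    (hFC : ForceContentVisible (3 / 2000) 4 6 (1 / 1000) 12 (1 / 25) (1 / 2000) 4 6)
    (h2 : NearSecondOrderFloor (3 / 2000) 4 6 (1 / 1000) 12 (1 / 25) (1 / 2000) (1 / (4 * 10 ^ 7)))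
    (hZ : FarAggregatePricing 12 (1 / 25) (1 / 2000) (1 / (2 * 10 ^ 7))) (hM : AffMidAll 12 (1 / 25))
    (hCE : CleanlessExcessT) (hRes : CoherentResidual 10) : RobustDefectLimitWindows :=
  rdef_of_ceg_shape_nearPricedFloor_record hCEG hT hK hR hCP
    (nearPricedSkeletonFloor_record_of_core_of_shell hRC hRS) hFC h2 hZ hM hCE hRes

end Summit.AtomisticToContinuum.Crystallization.Theorems.OverbindingBudgetAffineNearCluster
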